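import Summits.QuantumFields.QCD.Theses.HeatSlicedQuarks
import Summits.QuantumFields.QCD.Theorems.HeatSlicedQuarksSmallFieldUltracontractivity
import Summits.QuantumFields.QCD.Theorems.HeatSlicedQuarksInterleavedHeatSliceFlowStubColumnIdentificationAux
import Summits.QuantumFields.QCD.Theorems.HeatSlicedQuarksSmallFieldUltracontractivityFixedPointA
import Summits.QuantumFields.QCD.Theorems.HeatSlicedQuarksInterleavedHeatSliceFlowStubGramRepresentation
import Summits.QuantumFields.QCD.Theorems.HeatSlicedQuarksInterleavedHeatSliceFlowStubColumnSmoothing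
import Summits.QuantumFields.QCD.Theorems.HeatSlicedQuarksInterleavedHeatSliceFlowStubGammaFiveDiagonal
import Summits.QuantumFields.QCD.Theorems.HeatSlicedQuarksInterleavedHeatSliceFlowStubColumnIntegral
import Literature.Analysis.InnerProduct.GramHadamard

/-!
# Stub `stub_slicedGramBound` of line `Sketch` (crux `InterleavedHeatSliceFlow`, item stmt-QuantumFields-8891):
# the SLICED GRAM / DETERMINANT BOUND for the heat-slice quark covariance, assembled from the four landed
# stubs of reshape r7 (`stub_gramRepresentation` p141202, `stub_columnSmoothing` p141180,
# `stub_gammaFiveDiagonal` p141235, `stub_columnIntegral` p141278)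

This is the item of the route text's "NOT DECOMPOSED YET … provable now" list: "the sliced Gram/determinant
bound det[C_ℓ(x_i,y_j)] ≤ (Cℓ⁻³)ⁿ (corollary of 8871 + γ₅-hermiticity + T*T)" — content (ii) of the flow glue
`InterleavedFlowProper` (item 18031): the det-bound WITHOUT FACTORIALS that Gawędzki–Kupiainen /
Feldman–Magnen–Rivasseau–Sénéor fermionic slice integrations need, with constants independent of the
background gauge field on Bałaban small-field balls.

The **sliced Gram / determinant bound**: with `D = D_W(U,m,1)`, `H = DᴴD`, `K(t) = e^{-tH}`, the `n × n`
determinant of the heat-slice covariance `C_{a,b}(U)(ξ_i,η_j) = ∫_a^b (K(t) Dᴴ)(ξ_i,η_j) dt`,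
`2 ≤ a ≤ b ≤ r²`, obeys `|det| ≤ (C/(a√a))ⁿ` whenever the sites of the `ξ_i, η_j` are centres of
`K·r`-balls of `(ε/r²)²`-small plaquettes — factorial-free, constants background-independent.

## Proof (theorem `slicedGramBound_of_stubs`, with the four stub STATEMENTS as hypotheses `h1`–`h4`)

* `SmallFieldUltracontractivity_of` (item 8871, PROVED) gives `ε, K, C₀` with
  `|K(t)((x,c,s),(x,c',s'))| ≤ C₀/t²` for `1 ≤ t ≤ r²` at every admissible centre `x`; we use
  `C₁ := max C₀ 0` and `C := 2 C₁`.
* Gram representation (`h1 = stub_gramRepresentation` at `s = a/2`, plus hermiticity of `K(a/2)`):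
  `C(ξ_i,η_j) = ⟪f_i, g_j⟫_{ℓ²}` with `f_i = column ξ_i of K(a/2)` and
  `g_j = column η_j of ∫_a^b K(t - a/2) Dᴴ dt`.
* `‖f_i‖² = Re K(a)(ξ_i,ξ_i) ≤ C₁/a²` (landed `sum_norm_sq_col_eq_re_apply_self` + SFU at `t = a`).
* `‖g_j‖ ≤ 2√2 √(C₁/e)/√a`: for `a ≤ t ≤ b`, `σ = t - a/2 ∈ [1, r²]`, column smoothing
  (`h2 = stub_columnSmoothing`), the `γ₅` diagonal identity (`h3 = stub_gammaFiveDiagonal`) and SFU at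
  time `σ` give `‖column_{η_j}(K(σ)Dᴴ)‖₂ ≤ √(C₁/e)/(σ√σ)`; Minkowski in time (`h4 = stub_columnIntegral`).
* Gram–Hadamard (`Literature.Analysis.InnerProduct.norm_det_inner_le_prod_norm_mul_prod_norm`):
  `|det| ≤ ∏‖f_i‖ ∏‖g_j‖ ≤ (√C₁/a · 2√2√(C₁/e)/√a)ⁿ ≤ (2C₁/(a√a))ⁿ` using `2 ≤ e`.
-/

noncomputable section

namespace Summit.QuantumFields.QCD.Cruxes.InterleavedHeatSliceFlow.Sketch

open Literature.MathematicalPhysics.QuantumLattice Literature.MathematicalPhysics.QuantumFieldTheory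
  Literature.Probability.LatticeModels
open Summit.QuantumFields.QCD.Theses.HeatSlicedQuarks
open Summit.QuantumFields.QCD.Theorems.SmallFieldUltracontractivity.Negative
open Summit.QuantumFields.QCD.Cruxes.SmallFieldUltracontractivity.PointCentredAxialParabolic
open MeasureTheory intervalIntegral
open scoped Matrix ComplexConjugate InnerProductSpace

/-! ### Generic `ℓ²` helpers -/

/-- For a Hermitian matrix `K`, the `ℓ²` inner product of its column `p` with a vector `w` is the
`p`-th entry of `K w`: `⟪col_p K, w⟫ = Σ_ζ K(p,ζ) w(ζ)` (the conjugate of a column is a row). -/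
theorem inner_toLp_col_eq_sum_of_isHermitian {ι : Type*} [Fintype ι] {K : Matrix ι ι ℂ}
    (hK : K.IsHermitian) (p : ι) (w : ι → ℂ) :
    ⟪(WithLp.toLp 2 fun ζ => K ζ p : EuclideanSpace ℂ ι), (WithLp.toLp 2 w : EuclideanSpace ℂ ι)⟫_ℂ =
      ∑ ζ, K p ζ * w ζ := by
  rw [PiLp.inner_apply]
  refine Finset.sum_congr rfl fun ζ _ => ?_
  simp only [RCLike.inner_apply']
  congr 1
  rw [starRingEnd_apply, ← Matrix.conjTranspose_apply K ζ p, hK.eq]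

/-- **Gram–Hadamard with uniform bounds**: if `‖f_i‖ ≤ C_f` (`C_f ≥ 0`) and `‖g_j‖ ≤ C_g` for all `i, j`,
then `|det [⟪f_i, g_j⟫]| ≤ (C_f C_g)ⁿ` — no `n!`. -/
theorem norm_det_of_inner_le {ι : Type*} [Fintype ι] {n : ℕ} {Cf Cg : ℝ}
    (f g : Fin n → EuclideanSpace ℂ ι) (hCf : 0 ≤ Cf) (hf : ∀ i, ‖f i‖ ≤ Cf) (hg : ∀ j, ‖g j‖ ≤ Cg) :
    ‖(Matrix.of fun i j => ⟪f i, g j⟫_ℂ).det‖ ≤ (Cf * Cg) ^ n := by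
  refine (Literature.Analysis.InnerProduct.norm_det_inner_le_prod_norm_mul_prod_norm f g).trans ?_
  have h1 : ∏ i, ‖f i‖ ≤ Cf ^ n := by
    calc ∏ i, ‖f i‖ ≤ ∏ _i : Fin n, Cf :=
          Finset.prod_le_prod (fun _ _ => norm_nonneg _) fun i _ => hf i
      _ = Cf ^ n := by rw [Finset.prod_const, Finset.card_univ, Fintype.card_fin]
  have h2 : ∏ j, ‖g j‖ ≤ Cg ^ n := by
    calc ∏ j, ‖g j‖ ≤ ∏ _j : Fin n, Cg :=
          Finset.prod_le_prod (fun _ _ => norm_nonneg _) fun j _ => hg j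
      _ = Cg ^ n := by rw [Finset.prod_const, Finset.card_univ, Fintype.card_fin]
  calc (∏ i, ‖f i‖) * ∏ j, ‖g j‖ ≤ Cf ^ n * Cg ^ n :=
        mul_le_mul h1 h2 (Finset.prod_nonneg fun _ _ => norm_nonneg _) (pow_nonneg hCf _)
    _ = (Cf * Cg) ^ n := by rw [mul_pow]

/-- The elementary constant comparison `√C/a · 2√2 √(C/e)/√a ≤ 2C/(a√a)` (i.e. `√2 ≤ √e`). -/
theorem sqrt_mul_smoothing_const_le {C a : ℝ} (hC : 0 ≤ C) (ha : 0 < a) :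
    Real.sqrt C / a * (2 * Real.sqrt 2 * Real.sqrt (C / Real.exp 1) / Real.sqrt a) ≤
      2 * C / (a * Real.sqrt a) := by
  have he : 0 < Real.exp 1 := Real.exp_pos 1
  have hse : 0 < Real.sqrt (Real.exp 1) := Real.sqrt_pos.mpr he
  have h2e : Real.sqrt 2 ≤ Real.sqrt (Real.exp 1) :=
    Real.sqrt_le_sqrt (by linarith [Real.add_one_le_exp (1 : ℝ)])
  have hsa : 0 < Real.sqrt a := Real.sqrt_pos.mpr ha
  rw [div_mul_div_comm, Real.sqrt_div hC]
  refine div_le_div_of_nonneg_right ?_ (by positivity)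
  calc Real.sqrt C * (2 * Real.sqrt 2 * (Real.sqrt C / Real.sqrt (Real.exp 1)))
      = 2 * (Real.sqrt C * Real.sqrt C) * (Real.sqrt 2 / Real.sqrt (Real.exp 1)) := by ring
    _ = 2 * C * (Real.sqrt 2 / Real.sqrt (Real.exp 1)) := by rw [Real.mul_self_sqrt hC]
    _ ≤ 2 * C * 1 :=
        mul_le_mul_of_nonneg_left ((div_le_one hse).mpr h2e) (by positivity)
    _ = 2 * C := mul_one _

/-! ### The generic sliced Gram bound (any matrix `A`, diagonal heat-kernel bounds as hypotheses) -/

/-- **Sliced Gram bound, generic core.**  Let `A` be a complex square matrix, `2 ≤ a ≤ b`, `0 ≤ C₁`, and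
suppose: the Gram representation `h1`, the column smoothing `h2` and the time-Minkowski bound `h4` (the
statements of the stubs `stub_gramRepresentation`, `stub_columnSmoothing`, `stub_columnIntegral`), the
diagonal identity `e^{-tAAᴴ}(q,q) = e^{-tAᴴA}(q,q)`, and the diagonal heat-kernel bounds
`|e^{-aAᴴA}(ξ_i,ξ_i)| ≤ C₁/a²`, `|e^{-tAᴴA}(η_j,η_j)| ≤ C₁/t²` (`1 ≤ t ≤ b`).  Then
`|det [∫_a^b (e^{-tAᴴA}Aᴴ)(ξ_i,η_j) dt]| ≤ (2C₁/(a√a))ⁿ`. -/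
theorem norm_det_slice_le {ι : Type} [Fintype ι] [DecidableEq ι]
    (h1 : ∀ (ι : Type) [Fintype ι] [DecidableEq ι] (A : Matrix ι ι ℂ) (s a b : ℝ) (ξ η : ι),
      (∫ t in a..b, (NormedSpace.exp (-(t : ℂ) • (Aᴴ * A)) * Aᴴ) ξ η) =
        ∑ ζ, (NormedSpace.exp (-(s : ℂ) • (Aᴴ * A))) ξ ζ *
          ∫ t in a..b, (NormedSpace.exp (-((t - s : ℝ) : ℂ) • (Aᴴ * A)) * Aᴴ) ζ η)
    (h2 : ∀ (ι : Type) [Fintype ι] [DecidableEq ι] (A : Matrix ι ι ℂ) (σ : ℝ), 0 < σ → ∀ (η : ι),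
      ∑ ζ, ‖(NormedSpace.exp (-(σ : ℂ) • (Aᴴ * A)) * Aᴴ) ζ η‖ ^ 2 ≤
        (Real.exp 1 * σ)⁻¹ * ((NormedSpace.exp (-(σ : ℂ) • (A * Aᴴ))) η η).re)
    (h4 : ∀ (ι : Type) [Fintype ι] (v : ι → ℂ) (F : ℝ → ι → ℂ) (a b M : ℝ), 0 < a → a ≤ b → 0 ≤ M →
      (∀ q, v q = ∫ t in a..b, F t q) → (∀ q, ContinuousOn (fun t => F t q) (Set.Icc a b)) →
      (∀ t, a ≤ t → t ≤ b →
        Real.sqrt (∑ q, ‖F t q‖ ^ 2) ≤ M / ((t - a / 2) * Real.sqrt (t - a / 2))) →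
      Real.sqrt (∑ q, ‖v q‖ ^ 2) ≤ 2 * Real.sqrt 2 * M / Real.sqrt a)
    (A : Matrix ι ι ℂ) {a b C₁ : ℝ} (ha : 2 ≤ a) (hab : a ≤ b) (hC₁ : 0 ≤ C₁) {n : ℕ} (ξ η : Fin n → ι)
    (hdiag : ∀ (t : ℝ) (q : ι),
      (NormedSpace.exp (-(t : ℂ) • (A * Aᴴ))) q q = (NormedSpace.exp (-(t : ℂ) • (Aᴴ * A))) q q)
    (hξ : ∀ i, ‖(NormedSpace.exp (-(a : ℂ) • (Aᴴ * A))) (ξ i) (ξ i)‖ ≤ C₁ / a ^ 2)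
    (hη : ∀ j (t : ℝ), 1 ≤ t → t ≤ b →
      ‖(NormedSpace.exp (-(t : ℂ) • (Aᴴ * A))) (η j) (η j)‖ ≤ C₁ / t ^ 2) :
    ‖(Matrix.of fun i j => ∫ t in a..b,
        (NormedSpace.exp (-(t : ℂ) • (Aᴴ * A)) * Aᴴ) (ξ i) (η j)).det‖ ≤
      (2 * C₁ / (a * Real.sqrt a)) ^ n := by
  have ha0 : 0 < a := by linarith
  have hsa : 0 < Real.sqrt a := Real.sqrt_pos.mpr ha0
  have he : 0 < Real.exp 1 := Real.exp_pos 1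
  have hM0 : 0 ≤ Real.sqrt (C₁ / Real.exp 1) := Real.sqrt_nonneg _
  have hKa : (NormedSpace.exp (-((a / 2 : ℝ) : ℂ) • (Aᴴ * A))).IsHermitian :=
    isHermitian_exp_neg_smul A (a / 2)
  -- Gram representation of the entries
  have hentry : (Matrix.of fun i j => ∫ t in a..b,
        (NormedSpace.exp (-(t : ℂ) • (Aᴴ * A)) * Aᴴ) (ξ i) (η j)) =
      Matrix.of fun i j =>
        ⟪(WithLp.toLp 2 fun ζ => (NormedSpace.exp (-((a / 2 : ℝ) : ℂ) • (Aᴴ * A))) ζ (ξ i) :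
            EuclideanSpace ℂ ι),
          (WithLp.toLp 2 fun ζ => ∫ t in a..b,
              (NormedSpace.exp (-((t - a / 2 : ℝ) : ℂ) • (Aᴴ * A)) * Aᴴ) ζ (η j) :
            EuclideanSpace ℂ ι)⟫_ℂ := by
    ext i j
    rw [Matrix.of_apply, Matrix.of_apply, inner_toLp_col_eq_sum_of_isHermitian hKa,
      h1 ι A (a / 2) a b (ξ i) (η j)]
  rw [hentry]
  refine (norm_det_of_inner_le (Cf := Real.sqrt C₁ / a)
    (Cg := 2 * Real.sqrt 2 * Real.sqrt (C₁ / Real.exp 1) / Real.sqrt a) _ _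
    (div_nonneg (Real.sqrt_nonneg C₁) ha0.le) (fun i => ?_) (fun j => ?_)).trans
    (pow_le_pow_left₀ (by positivity) (sqrt_mul_smoothing_const_le hC₁ ha0) n)
  · -- ‖f i‖ ≤ √C₁ / a
    rw [norm_toLp_two_eq_sqrt, sum_norm_sq_col_eq_re_apply_self A (a / 2) (ξ i)]
    have h2a : (2 * (a / 2) : ℝ) = a := by ring
    rw [h2a]
    calc Real.sqrt ((NormedSpace.exp (-(a : ℂ) • (Aᴴ * A))) (ξ i) (ξ i)).re
        ≤ Real.sqrt (C₁ / a ^ 2) := Real.sqrt_le_sqrt ((Complex.re_le_norm _).trans (hξ i))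
      _ = Real.sqrt C₁ / a := by rw [Real.sqrt_div' C₁ (sq_nonneg a), Real.sqrt_sq ha0.le]
  · -- ‖g j‖ ≤ 2√2 √(C₁/e) / √a
    rw [norm_toLp_two_eq_sqrt]
    refine h4 ι (fun ζ => ∫ t in a..b,
        (NormedSpace.exp (-((t - a / 2 : ℝ) : ℂ) • (Aᴴ * A)) * Aᴴ) ζ (η j))
      (fun t ζ => (NormedSpace.exp (-((t - a / 2 : ℝ) : ℂ) • (Aᴴ * A)) * Aᴴ) ζ (η j)) a b
      (Real.sqrt (C₁ / Real.exp 1)) ha0 hab hM0 (fun q => rfl) (fun q => ?_) (fun t hat htb => ?_)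
    · -- continuity of the integrand in `t`
      open scoped Matrix.Norms.Operator in
      exact (((NormedSpace.exp_continuous.comp
        ((Complex.continuous_ofReal.comp (continuous_sub_right (a / 2))).neg.smul
          continuous_const)).mul continuous_const).matrix_elem q (η j)).continuousOn
    · -- pointwise bound at time `t`, `σ = t - a/2 ∈ [1, b]`
      set σ : ℝ := t - a / 2 with hσdef
      have hσ0 : 0 < σ := by rw [hσdef]; linarith
      have hσ1 : 1 ≤ σ := by rw [hσdef]; linarith
      have hσb : σ ≤ b := by rw [hσdef]; linarith
      have hS := h2 ι A σ hσ0 (η j)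
      rw [hdiag σ (η j)] at hS
      have hre : ((NormedSpace.exp (-(σ : ℂ) • (Aᴴ * A))) (η j) (η j)).re ≤ C₁ / σ ^ 2 :=
        (Complex.re_le_norm _).trans (hη j σ hσ1 hσb)
      have hsum : ∑ ζ, ‖(NormedSpace.exp (-(σ : ℂ) • (Aᴴ * A)) * Aᴴ) ζ (η j)‖ ^ 2 ≤
          (Real.exp 1 * σ)⁻¹ * (C₁ / σ ^ 2) :=
        hS.trans (mul_le_mul_of_nonneg_left hre (inv_nonneg.mpr (by positivity)))
      rw [Real.sqrt_le_iff]
      refine ⟨by positivity, hsum.trans (le_of_eq ?_)⟩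
      rw [div_pow, mul_pow, Real.sq_sqrt hσ0.le, Real.sq_sqrt (div_nonneg hC₁ he.le)]
      field_simp

/-! ### The assembly -/

/-- **Sliced Gram / determinant bound from the four stubs** (assembly of the registered stub
`stub_slicedGramBound` of line `Sketch`; the hypotheses `h1`–`h4` are VERBATIM the statements of the
registered stubs `stub_gramRepresentation`, `stub_columnSmoothing`, `stub_gammaFiveDiagonal`,
`stub_columnIntegral`, and the conclusion is verbatim the statement of `stub_slicedGramBound`):
there are `ε > 0`, `K`, `C` such that for every torus, SU(3) field `U`, mass `m ∈ [-1/2,1]`, scale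
`1 ≤ r ≤ L`, slice `2 ≤ a ≤ b ≤ r²` and points `ξ₁…ξₙ, η₁…ηₙ` whose sites are centres of `K·r`-balls of
`(ε/r²)²`-small plaquettes, `|det [∫_a^b (e^{-tD_WᴴD_W} D_Wᴴ)(ξ_i,η_j) dt]| ≤ (C/(a√a))ⁿ`.  The constants are
`ε, K` of `SmallFieldUltracontractivity_of` (item 8871) and `C = 2 max(C₀, 0)`. -/
theorem slicedGramBound_of_stubs
    (h1 : ∀ (ι : Type) [Fintype ι] [DecidableEq ι] (A : Matrix ι ι ℂ) (s a b : ℝ) (ξ η : ι),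
      (∫ t in a..b, (NormedSpace.exp (-(t : ℂ) • (Aᴴ * A)) * Aᴴ) ξ η) =
        ∑ ζ, (NormedSpace.exp (-(s : ℂ) • (Aᴴ * A))) ξ ζ *
          ∫ t in a..b, (NormedSpace.exp (-((t - s : ℝ) : ℂ) • (Aᴴ * A)) * Aᴴ) ζ η)
    (h2 : ∀ (ι : Type) [Fintype ι] [DecidableEq ι] (A : Matrix ι ι ℂ) (σ : ℝ), 0 < σ → ∀ (η : ι),
      ∑ ζ, ‖(NormedSpace.exp (-(σ : ℂ) • (Aᴴ * A)) * Aᴴ) ζ η‖ ^ 2 ≤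
        (Real.exp 1 * σ)⁻¹ * ((NormedSpace.exp (-(σ : ℂ) • (A * Aᴴ))) η η).re)
    (h3 : ∀ (L : ℕ) [NeZero L] (U : GaugeConfig 4 L (Matrix.specialUnitaryGroup (Fin 3) ℂ)) (m t : ℝ)
      (η : TorusSite 4 L × Fin 3 × Fin 4),
      (NormedSpace.exp (-(t : ℂ) • (wilsonDirac (fundamentalRep (Fin 3)) U m 1 *
          (wilsonDirac (fundamentalRep (Fin 3)) U m 1)ᴴ))) η η =
        (NormedSpace.exp (-(t : ℂ) • ((wilsonDirac (fundamentalRep (Fin 3)) U m 1)ᴴ *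
          wilsonDirac (fundamentalRep (Fin 3)) U m 1))) η η)
    (h4 : ∀ (ι : Type) [Fintype ι] (v : ι → ℂ) (F : ℝ → ι → ℂ) (a b M : ℝ), 0 < a → a ≤ b → 0 ≤ M →
      (∀ q, v q = ∫ t in a..b, F t q) → (∀ q, ContinuousOn (fun t => F t q) (Set.Icc a b)) →
      (∀ t, a ≤ t → t ≤ b →
        Real.sqrt (∑ q, ‖F t q‖ ^ 2) ≤ M / ((t - a / 2) * Real.sqrt (t - a / 2))) →
      Real.sqrt (∑ q, ‖v q‖ ^ 2) ≤ 2 * Real.sqrt 2 * M / Real.sqrt a) :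
    ∃ ε : ℝ, 0 < ε ∧ ∃ K : ℕ, ∃ C : ℝ, ∀ (L : ℕ) [NeZero L]
      (U : GaugeConfig 4 L (Matrix.specialUnitaryGroup (Fin 3) ℂ)) (m : ℝ), m ∈ Set.Icc (-(1 / 2 : ℝ)) 1 →
      ∀ (r : ℕ), 1 ≤ r → r ≤ L → ∀ (a b : ℝ), 2 ≤ a → a ≤ b → b ≤ (r : ℝ) ^ 2 →
      ∀ (n : ℕ) (ξ η : Fin n → TorusSite 4 L × Fin 3 × Fin 4),
      (∀ (i : Fin n) (y : TorusSite 4 L), torusDist (ξ i).1 y ≤ K * r → ∀ (μ ν : Fin 4),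
        3 - ((fundamentalRep (Fin 3)) (plaquetteHolonomy U y μ ν)).trace.re ≤ (ε / (r : ℝ) ^ 2) ^ 2) →
      (∀ (j : Fin n) (y : TorusSite 4 L), torusDist (η j).1 y ≤ K * r → ∀ (μ ν : Fin 4),
        3 - ((fundamentalRep (Fin 3)) (plaquetteHolonomy U y μ ν)).trace.re ≤ (ε / (r : ℝ) ^ 2) ^ 2) →
      ‖(Matrix.of fun i j => ∫ t in a..b,
          ((NormedSpace.exp (-(t : ℂ) • ((wilsonDirac (fundamentalRep (Fin 3)) U m 1)ᴴ *
              wilsonDirac (fundamentalRep (Fin 3)) U m 1)) *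
            (wilsonDirac (fundamentalRep (Fin 3)) U m 1)ᴴ) (ξ i) (η j))).det‖ ≤
        (C / (a * Real.sqrt a)) ^ n := by
  obtain ⟨ε, hε, K, C₀, hSFU⟩ := SmallFieldUltracontractivity_of
  refine ⟨ε, hε, K, 2 * max C₀ 0, ?_⟩
  intro L _ U m hm r hr hrL a b ha hab hb n ξ η hξ hη
  have hC₁ : (0 : ℝ) ≤ max C₀ 0 := le_max_right _ _
  have ha1 : (1 : ℝ) ≤ a := by linarith
  -- SFU (item 8871) at an admissible centre, all colour–spin diagonal entries, constant `max C₀ 0`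
  have hSFU' : ∀ p : TorusSite 4 L × Fin 3 × Fin 4,
      (∀ y : TorusSite 4 L, torusDist p.1 y ≤ K * r → ∀ μ ν : Fin 4,
        3 - ((fundamentalRep (Fin 3)) (plaquetteHolonomy U y μ ν)).trace.re ≤ (ε / (r : ℝ) ^ 2) ^ 2) →
      ∀ t : ℝ, 1 ≤ t → t ≤ b →
        ‖(NormedSpace.exp (-(t : ℂ) • ((wilsonDirac (fundamentalRep (Fin 3)) U m 1)ᴴ *
            wilsonDirac (fundamentalRep (Fin 3)) U m 1))) p p‖ ≤ max C₀ 0 / t ^ 2 := by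
    intro p hp t ht htb
    have h := hSFU L U m hm p.1 r hr hrL hp t ht (htb.trans hb) p.2.1 p.2.1 p.2.2 p.2.2
    exact h.trans (div_le_div_of_nonneg_right (le_max_left _ _) (by positivity))
  exact norm_det_slice_le h1 h2 h4 (wilsonDirac (fundamentalRep (Fin 3)) U m 1) ha hab hC₁ ξ η
    (fun t q => h3 L U m t q) (fun i => hSFU' (ξ i) (hξ i) a ha1 hab)
    (fun j t ht htb => hSFU' (η j) (hη j) t ht htb)

/-- **Registered stub `stub_slicedGramBound` of line `Sketch` — the sliced Gram / determinant bound, a THEOREM**: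
there are `ε > 0`, `K`, `C` (those of `SmallFieldUltracontractivity_of`, item 8871, and `C = 2 max(C₀,0)`) such
that for every torus side `L`, SU(3) field `U`, bare mass `m ∈ [-1/2, 1]`, scale `1 ≤ r ≤ L`, heat slice
`2 ≤ a ≤ b ≤ r²` and points `ξ₁…ξₙ, η₁…ηₙ` whose sites are centres of `K·r`-balls on which every plaquette
deficit is `≤ (ε/r²)²`, the `n × n` determinant of the heat-slice covariance
`C_{a,b}(U)(ξ_i,η_j) = ∫_a^b (e^{-tD_WᴴD_W} D_Wᴴ)(ξ_i,η_j) dt` satisfies `|det| ≤ (C/(a√a))ⁿ` — factorial-free,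
background-independent constants (with `a = ℓ²` this is the `(Cℓ⁻³)ⁿ` Gram bound of the GK/FMRS slice
integrations).  Proof: `slicedGramBound_of_stubs` fed with the four landed stubs. -/
theorem stub_slicedGramBound :
    ∃ ε : ℝ, 0 < ε ∧ ∃ K : ℕ, ∃ C : ℝ, ∀ (L : ℕ) [NeZero L]
      (U : GaugeConfig 4 L (Matrix.specialUnitaryGroup (Fin 3) ℂ)) (m : ℝ), m ∈ Set.Icc (-(1 / 2 : ℝ)) 1 →
      ∀ (r : ℕ), 1 ≤ r → r ≤ L → ∀ (a b : ℝ), 2 ≤ a → a ≤ b → b ≤ (r : ℝ) ^ 2 →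
      ∀ (n : ℕ) (ξ η : Fin n → TorusSite 4 L × Fin 3 × Fin 4),
      (∀ (i : Fin n) (y : TorusSite 4 L), torusDist (ξ i).1 y ≤ K * r → ∀ (μ ν : Fin 4),
        3 - ((fundamentalRep (Fin 3)) (plaquetteHolonomy U y μ ν)).trace.re ≤ (ε / (r : ℝ) ^ 2) ^ 2) →
      (∀ (j : Fin n) (y : TorusSite 4 L), torusDist (η j).1 y ≤ K * r → ∀ (μ ν : Fin 4),
        3 - ((fundamentalRep (Fin 3)) (plaquetteHolonomy U y μ ν)).trace.re ≤ (ε / (r : ℝ) ^ 2) ^ 2) →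
      ‖(Matrix.of fun i j => ∫ t in a..b,
          ((NormedSpace.exp (-(t : ℂ) • ((wilsonDirac (fundamentalRep (Fin 3)) U m 1)ᴴ *
              wilsonDirac (fundamentalRep (Fin 3)) U m 1)) *
            (wilsonDirac (fundamentalRep (Fin 3)) U m 1)ᴴ) (ξ i) (η j))).det‖ ≤
        (C / (a * Real.sqrt a)) ^ n :=
  slicedGramBound_of_stubs stub_gramRepresentation stub_columnSmoothing stub_gammaFiveDiagonal
    stub_columnIntegral

end Summit.QuantumFields.QCD.Cruxes.InterleavedHeatSliceFlow.Sketch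

end
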